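/-
Copyright (c) 2026 the pub-hodgecm-mathlib formalisation cell (harness21).  Prover seat hodgecm-mathlib-K2E3-p37 (g0), Track B «K2-LIT» ∕ h413 =
`stmt-HodgeConjecture-24833`, line `K2_E3_EllipticInputs`, unit U4 «Keys», PART «U4Keys» socket :182 (U4f-χ₁-ram-one-pos)
`sig_K2E3KeysThmTwoContractingRamifiedCharOnePosDepth` (LINE-LEAD K2E3-plan (g4) L4∕E3 EMIT #5 deal D163 2026-09-04T15:31:56Z; R0 census + addenda
`K2/K2E3-p37/g0/CENSUS-U4f-PosDepth.K2E3-p37-g0.md`): programme A_pos brick (v)-prep «PREPENDING A LEVEL TO AN IWAHORI DATUM» — generic: an Iwahori datum `𝓘` and a compact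
open `J ≤ 𝓘.K 0` with its own Iwahori factorisation give an Iwahori datum with first level `J` (at positive depth: `J = J_n` of ★ p861548 under `I = 𝓘.K 0`).  REPORT-FIRST 2026-09-04.
-/
import Literature.NumberTheory.Automorphic.JacquetModule   -- ★ `ParabolicTriple`, `ParabolicTriple.IwahoriDatum` (fields `Nbar a K isOpen_K isCompact_K hasBasis_K factorization exists_conj_inf_Nbar_le`)
import HarnessLib

/-!
# K2 ∕ E3 «EllipticInputs», unit U4 «Keys» — (U4f-χ₁-ram-one-pos), programme A_pos brick (v)-prep: PREPENDING A COMPACT OPEN LEVEL `J` TO AN IWAHORI DATUM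
# «`𝓘` an Iwahori datum of `(G ⊇ P = MN)`, `J ≤ 𝓘.K 0` compact open with `J = (J ∩ N̄)(J ∩ M)(J ∩ N)` ⟹ an Iwahori datum `𝓘′` with `𝓘′.K 0 = J`, `𝓘′.K (j+1) = 𝓘.K j`, same `N̄`, same `a`»
# [Casselman1995 Prop. 1.4.4; BruhatTits1972 (4.4.3)–(4.4.4); BernsteinZelevinsky1976 §3.13]

Cell hodgecm-mathlib, Track B «K2-LIT», crux item H413 = stmt-HodgeConjecture-24833 (route `HCCMUnconditional`, no route verbs); target BY NAME the OPEN tier-0 leaf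
`…K2E3EllipticInputs.U4Keys.sig_K2E3KeysThmTwoContractingRamifiedCharOnePosDepth` (U4Keys ED. 8 :182), design D-I «vanishing functional» at POSITIVE depth.  Author K2E3-p37 (g0).
`--supports stmt-HodgeConjecture-24833 --as helper`; THEOREMS ONLY (no `def` ∕ `instance` ∕ `notation` ∕ named fact ∕ `sorry`; the datum is delivered as an EXISTENCE theorem, as in
★ `K2E3IwahoriLevelDatum.exists_iwahoriDatum_iwahoriLevel` ∕ ★ `K2E3IwahoriDetection.exists_iwahoriDatum_K_zero_eq`); GENERIC (any group `G` with a topology, any `ParabolicTriple`).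
NOT THE PAYER of :182.

THE POINT.  The depth-zero Branch-A assembly (★ `K2E3BranchATypeLettersCM` §1, ★ `K2E3BranchAIrreducibleDepthZero`) runs on an Iwahori datum `𝓘` of `cmBorelTriple L 3 v` with
`𝓘.K 0 = I`: ★ Z2A-2 `K2E3IwahoriDatumDilation` (a dilate of `f` is fixed by `𝓘.K n ∩ N̄`) and ★ V2b `K2E3TypeVectorOfSubrepFactored` (the type vector from `𝓘.factorization 0`)
only see `𝓘` through the `IwahoriDatum` interface.  At positive depth the same two steps want a datum whose FIRST level is the level-`n` Iwahori `J_n ≤ I` (★ p861548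
`K2E3IwahoriLevelNFactorisation`: compact open, `J_n = (J_n ∩ N̄)(J_n ∩ T)(J_n ∩ N)`).  THIS FILE supplies it abstractly: given ANY Iwahori datum `𝓘` and a compact open subgroup
`J ≤ 𝓘.K 0` with the Iwahori factorisation relative to `(𝓘.N̄, M, N)`, the sequence `J, 𝓘.K 0, 𝓘.K 1, …` (same `N̄`, same contracting element `a`) is again an Iwahori datum:
openness ∕ compactness ∕ factorisation of the new first level are the hypotheses; the neighbourhood basis is `𝓘`'s, shifted; the CONTRACTION `a⁻ⁱ(J ∩ N̄)aⁱ ≤ K′ j` comes from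
`J ∩ N̄ ≤ 𝓘.K 0 ∩ N̄` and `𝓘`'s contraction for `j ≥ 1`, from `i = 0` for `j = 0`, and — for the old levels into the new first level — from `𝓘.hasBasis_K` applied to the open
neighbourhood `J` of `1`.  (No monotonicity of the levels is part of the interface, so nothing else is needed.)
* §1 `conjAct_smul_mono` (translating subgroups by `ConjAct` is monotone), `exists_K_le_of_isOpen` (some old level lies inside `J`).
* §2 **`exists_iwahoriDatum_prepend`** — `∃ 𝓘′, 𝓘′.K 0 = J ∧ 𝓘′.Nbar = 𝓘.Nbar ∧ 𝓘′.a = 𝓘.a ∧ ∀ j, 𝓘′.K (j + 1) = 𝓘.K j`.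
HONEST LABEL: HC_CM is proved only modulo the 7 printed citations (2 remaining named inputs: hLiu418 = stmt-HodgeConjecture-24832, h413 = stmt-HodgeConjecture-24833)
until rung 0 closes; count-neutral — this file does NOT pay the leaf; no printed citation is discharged.

## References
* [Casselman1995] W. Casselman, *Introduction to the theory of admissible representations of `p`-adic reductive groups* (1995), Prop. 1.4.4 (groups with Iwahori factorisation and a
  contracting torus element), Thm. 3.3.3.
* [BruhatTits1972] F. Bruhat, J. Tits, *Groupes réductifs sur un corps local I*, Publ. Math. IHÉS 41 (1972), (4.4.3)–(4.4.4).
* [BernsteinZelevinsky1976] I. N. Bernstein, A. V. Zelevinsky, *Representations of the group GL(n,F) where F is a non-archimedean local field*, Russian Math. Surveys 31:3 (1976), §3.13.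
-/

set_option autoImplicit false
-- the mandated namespace repeats the single-problem summit's segment (`HodgeConjecture.HodgeConjecture`)
set_option linter.dupNamespace false

open scoped Pointwise Topology

namespace Summit.HodgeConjecture.HodgeConjecture.Cruxes.H413.K2E3IwahoriDatumPrepend

open Literature.NumberTheory.Automorphic

variable {G : Type*} [Group G] [TopologicalSpace G] (t : ParabolicTriple G)

/-! ## §1 Two small facts about Iwahori data -/

omit [TopologicalSpace G] in
/-- Translating subgroups by an element of `ConjAct G` is monotone. [cite: Casselman1995, Prop. 1.4.4] -/
theorem conjAct_smul_mono (c : ConjAct G) {H H' : Subgroup G} (hle : H ≤ H') : c • H ≤ c • H' := by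
  intro x hx
  rw [Subgroup.mem_pointwise_smul_iff_inv_smul_mem] at hx ⊢
  exact hle hx

/-- **Some level of an Iwahori datum lies inside any open subgroup** (the levels form a neighbourhood basis of `1`). [cite: Casselman1995, Prop. 1.4.4] -/
theorem exists_K_le_of_isOpen (𝓘 : t.IwahoriDatum) (J : Subgroup G) (hJo : IsOpen (J : Set G)) : ∃ m : ℕ, 𝓘.K m ≤ J := by
  obtain ⟨m, hm⟩ := 𝓘.hasBasis_K (J : Set G) (hJo.mem_nhds J.one_mem)
  exact ⟨m, fun x hx => hm hx⟩

/-! ## §2 Prepending a level -/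

/-- **PREPENDING A COMPACT OPEN LEVEL TO AN IWAHORI DATUM.**  Let `𝓘` be an Iwahori datum of the parabolic triple `t` (levels `𝓘.K j`, opposite radical `𝓘.N̄`, contracting element
`𝓘.a ∈ M`), and `J ≤ 𝓘.K 0` a compact open subgroup with the Iwahori factorisation `J = (J ∩ N̄)·(J ∩ M)·(J ∩ N)` (as sets).  Then there is an Iwahori datum `𝓘′` of `t` with
`𝓘′.K 0 = J`, `𝓘′.K (j+1) = 𝓘.K j`, `𝓘′.N̄ = 𝓘.N̄`, `𝓘′.a = 𝓘.a`.  Contraction: `a⁻ⁱ(J ∩ N̄)aⁱ ≤ a⁻ⁱ(𝓘.K 0 ∩ N̄)aⁱ ≤ 𝓘.K j` (`𝓘`'s contraction, `conjAct_smul_mono`); into the new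
first level `J` via `exists_K_le_of_isOpen`; `i = 0` for `J ∩ N̄ ≤ J`.  At positive depth: `J = J_n` (★ `K2E3IwahoriLevelNFactorisation.coe_inf_pow_eq_mul`) under `𝓘.K 0 = I`
(★ `K2E3IwahoriDetection.exists_iwahoriDatum_K_zero_eq`). [cite: Casselman1995, Prop. 1.4.4] [cite: BruhatTits1972, (4.4.3)–(4.4.4)] [cite: BernsteinZelevinsky1976, §3.13] -/
theorem exists_iwahoriDatum_prepend (𝓘 : t.IwahoriDatum) (J : Subgroup G) (hJo : IsOpen (J : Set G)) (hJc : IsCompact (J : Set G))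
    (hle : J ≤ 𝓘.K 0)
    (hfac : (J : Set G) = ((J ⊓ 𝓘.Nbar : Subgroup G) : Set G) * ((J ⊓ t.M : Subgroup G) : Set G) * ((J ⊓ t.N : Subgroup G) : Set G)) :
    ∃ 𝓘' : t.IwahoriDatum, 𝓘'.K 0 = J ∧ 𝓘'.Nbar = 𝓘.Nbar ∧ 𝓘'.a = 𝓘.a ∧ ∀ j : ℕ, 𝓘'.K (j + 1) = 𝓘.K j := by
  -- the inclusion on the `N̄`-parts of the first levels
  have hleN : J ⊓ 𝓘.Nbar ≤ 𝓘.K 0 ⊓ 𝓘.Nbar := inf_le_inf_right _ hle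
  refine ⟨{ Nbar := 𝓘.Nbar
            a := 𝓘.a
            a_mem := 𝓘.a_mem
            a_comm := 𝓘.a_comm
            K := fun n => match n with
              | 0 => J
              | (j + 1) => 𝓘.K j
            isOpen_K := fun n => match n with
              | 0 => hJo
              | (j + 1) => 𝓘.isOpen_K j
            isCompact_K := fun n => match n with
              | 0 => hJc
              | (j + 1) => 𝓘.isCompact_K j
            hasBasis_K := fun U hU => by
              obtain ⟨m, hm⟩ := 𝓘.hasBasis_K U hU
              exact ⟨m + 1, hm⟩
            factorization := fun n => match n with
              | 0 => hfac
              | (j + 1) => 𝓘.factorization j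
            exists_conj_inf_Nbar_le := ?_ }, rfl, rfl, rfl, fun j => rfl⟩
  intro n j
  match n, j with
  | 0, 0 =>
      -- `a⁰ = 1`: `J ∩ N̄ ≤ J`
      refine ⟨0, ?_⟩
      show ConjAct.toConjAct (𝓘.a ^ 0)⁻¹ • (J ⊓ 𝓘.Nbar) ≤ J
      rw [pow_zero, inv_one, map_one, one_smul]
      exact inf_le_left
  | 0, (j + 1) =>
      -- into an old level: through `J ∩ N̄ ≤ K 0 ∩ N̄` and `𝓘`'s contraction
      obtain ⟨i, hi⟩ := 𝓘.exists_conj_inf_Nbar_le 0 j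
      refine ⟨i, ?_⟩
      show ConjAct.toConjAct (𝓘.a ^ i)⁻¹ • (J ⊓ 𝓘.Nbar) ≤ 𝓘.K j
      exact le_trans (conjAct_smul_mono _ hleN) hi
  | (n + 1), 0 =>
      -- an old level into the new first level: some `K m ≤ J`, then `𝓘`'s contraction into `K m`
      obtain ⟨m, hm⟩ := exists_K_le_of_isOpen t 𝓘 J hJo
      obtain ⟨i, hi⟩ := 𝓘.exists_conj_inf_Nbar_le n m
      refine ⟨i, ?_⟩
      show ConjAct.toConjAct (𝓘.a ^ i)⁻¹ • (𝓘.K n ⊓ 𝓘.Nbar) ≤ J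
      exact le_trans hi hm
  | (n + 1), (j + 1) =>
      obtain ⟨i, hi⟩ := 𝓘.exists_conj_inf_Nbar_le n j
      exact ⟨i, hi⟩

end Summit.HodgeConjecture.HodgeConjecture.Cruxes.H413.K2E3IwahoriDatumPrepend
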